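import Literature.Analysis.ValidatedNumerics.ExpPoly.Eval
import Literature.Analysis.ValidatedNumerics.ExpSumEnclosure

/-!
# Exact exp-polynomial algebra over `ℚ`, IV: formal sums as `ExpSum` term lists

The bridge between the two exact/validated representations of a finite exponential sum
`Σ c · e^{q}` (`c, q ∈ ℚ`) in this directory: the term lists `List ExpSum.ETerm` of
`ExpSumEnclosure.lean` (literal data `⟨cn, cd, qn, qd⟩`, real value `ExpSum.esum`, with kernel-checked
interval ENCLOSURES) and the formal sums `ExpPoly.FS` of `ExpPoly/Eval.lean` (pairs `(q, c)`, real
value `FS.eval`, with exact NORMAL FORMS, produced by the exact integrals of `ExpPoly/Calculus.lean`).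
`etermsFS` converts the former into the latter and `esum_eq_eval_etermsFS` says the real values
agree — so an identity proved on the `FS` side (by `FS.eval_eq_of_norm_eq` and `decide`) transfers to
an `esum`, which the enclosure checker then bounds numerically.

Origin: the package file `Dhl42/ClosedForm/Eterms.lean` (28 lines) of the DHL[42,2] certificate, where
it links the exact closed forms of the sieve's main terms to the enclosed term lists; declarations
unchanged but for the namespace; no number theory is stated.

## Main definitions (namespace `Literature.Analysis.ValidatedNumerics.ExpPoly`)

* `etermsFS : List ExpSum.ETerm → FS`.

## Main results

* `esum_eq_eval_etermsFS : ExpSum.esum L = FS.eval (etermsFS L)`.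

NOT here: the converse conversion (not needed: enclosures are computed on `ETerm` data directly).

## References

* `mkRat n d = n / d` in `ℚ`; bookkeeping between two list representations. [folklore]
-/

namespace Literature.Analysis.ValidatedNumerics.ExpPoly

open ExpSum

/-- `ETerm`s `(cn/cd) e^{qn/qd}` as a formal sum (pairs `(q, c) = (qn/qd, cn/cd)`). [folklore] -/
def etermsFS (L : List ETerm) : FS := L.map fun t => (mkRat t.qn t.qd, mkRat t.cn t.cd)

/-- The real value is preserved: `esum L = FS.eval (etermsFS L)` (termwise, `mkRat n d = n/d` cast to
`ℝ`). [folklore] -/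
theorem esum_eq_eval_etermsFS : ∀ L : List ETerm, esum L = FS.eval (etermsFS L)
  | [] => by simp [esum, etermsFS]
  | t :: L => by
      have ih := esum_eq_eval_etermsFS L
      simp only [esum, etermsFS, List.map_cons, FS.eval_cons] at ih ⊢
      rw [ih, ETerm.val, Rat.mkRat_eq_div, Rat.mkRat_eq_div]
      push_cast
      ring

end Literature.Analysis.ValidatedNumerics.ExpPoly
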